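import Summits.AnomalousDissipation.AnomalousDissipation.Theorems.TwoAndHalfDTwohalfdNegReductionOffZero

/-!
# Stub `stub_condensateFluctuationMeans` (E) of the line `log-kantorovich-enstrophy-transfer` for the
# crux `TwoAndHalfD.TwohalfdNeg` (stmt-AnomalousDissipation-0211): velocity-side means around a steady field

For a global Leray–Hopf solution `v` of the planar system under a steady `L²` force `g` and a
continuous steady field `V`, the fluctuation energy `W(τ) = ∫‖v(τ) − V‖²` is integrable on every
`(0, T]`, and its running mean obeys `timeMean W T ≤ 2 · timeMean (∫‖v‖²) T + 2∫‖V‖²`.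

Proof. Pointwise `‖a − b‖² ≤ 2‖a‖² + 2‖b‖²`, integrated in `x` for every `τ ∈ [0, T]`
(`v τ ∈ L²` by the Leray–Hopf class, `V ∈ L²` as a continuous field on the compact torus), gives
the slice bound `W(τ) ≤ 2∫‖v(τ)‖² + 2∫‖V‖²` on `[0, T]`. The fluctuation energy is jointly
measurable (Fubini on `(0, T) × T²`, `IsLerayHopfOn.aestronglyMeasurable_uncurry`) and dominated
by `2∫‖v‖² + 2∫‖V‖²`, whose first term is integrable on `(0, T]`
(`ReductionOffZero.integrableOn_integral_norm_sq`); the mean bound is monotonicity and additivity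
of the running means (`timeMean_mono_of_nonneg`, `timeMean_add`, `timeMean_const_mul`).
Supports stmt-AnomalousDissipation-0211.
-/

namespace Summit.AnomalousDissipation.AnomalousDissipation.Theorems.TwohalfdNeg.Condensate

open MeasureTheory Filter Topology
open scoped ENNReal NNReal InnerProductSpace
open Literature.Analysis.FunctionSpaces Literature.Analysis.FluidPDE

set_option linter.dupNamespace false

namespace FluctuationMeans

/-- **Slice bound**: `∫‖w − V‖² ≤ 2∫‖w‖² + 2∫‖V‖²` for `w, V ∈ L²(T²)` (pointwise parallelogram
bound `‖a − b‖² ≤ 2‖a‖² + 2‖b‖²`, integrated). [folklore] -/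
theorem integral_norm_sub_sq_le_two_mul_add {w V : UnitAddTorus (Fin 2) → EuclideanSpace ℝ (Fin 2)}
    (hw : MemLp w 2 volume) (hV : MemLp V 2 volume) :
    ∫ x, ‖w x - V x‖ ^ 2 ≤ 2 * (∫ x, ‖w x‖ ^ 2) + 2 * ∫ x, ‖V x‖ ^ 2 := by
  have i1 : Integrable (fun x => ‖w x‖ ^ 2) volume := hw.integrable_norm_pow two_ne_zero
  have i2 : Integrable (fun x => ‖V x‖ ^ 2) volume := hV.integrable_norm_pow two_ne_zero
  have i3 : Integrable (fun x => ‖w x - V x‖ ^ 2) volume := (hw.sub hV).integrable_norm_pow two_ne_zero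
  have hpt : ∀ x, ‖w x - V x‖ ^ 2 ≤ 2 * ‖w x‖ ^ 2 + 2 * ‖V x‖ ^ 2 := fun x => by
    have h1 : ‖w x - V x‖ ^ 2 ≤ (‖w x‖ + ‖V x‖) ^ 2 :=
      pow_le_pow_left₀ (norm_nonneg _) (norm_sub_le (w x) (V x)) 2
    nlinarith [sq_nonneg (‖w x‖ - ‖V x‖)]
  calc ∫ x, ‖w x - V x‖ ^ 2 ≤ ∫ x, (2 * ‖w x‖ ^ 2 + 2 * ‖V x‖ ^ 2) :=
        integral_mono i3 ((i1.const_mul 2).add (i2.const_mul 2)) hpt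
    _ = 2 * (∫ x, ‖w x‖ ^ 2) + 2 * ∫ x, ‖V x‖ ^ 2 := by
        rw [integral_add (i1.const_mul 2) (i2.const_mul 2), integral_const_mul, integral_const_mul]

variable {ν : ℝ} {g v₀ : UnitAddTorus (Fin 2) → EuclideanSpace ℝ (Fin 2)}
  {v : ℝ → UnitAddTorus (Fin 2) → EuclideanSpace ℝ (Fin 2)}
  {V : UnitAddTorus (Fin 2) → EuclideanSpace ℝ (Fin 2)} {T : ℝ}

/-- A continuous field on the compact torus `T²` is in `L²`. [folklore] -/
theorem memLp_two_of_continuous (hV : Continuous V) : MemLp V 2 volume :=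
  hV.memLp_of_hasCompactSupport (HasCompactSupport.of_compactSpace V)

/-- **(E1) Local integrability of the fluctuation energy**: for a global Leray–Hopf solution `v`
under a steady `L²` force and a continuous steady field `V`, `τ ↦ ∫‖v(τ) − V‖²` is integrable on
every `(0, T]` (jointly measurable by Fubini, dominated by `2∫‖v‖² + 2∫‖V‖²`). [folklore] -/
theorem integrableOn_integral_norm_sub_sq (hν : 0 < ν) (hg : MemLp g 2 volume)
    (hLH : Torus.IsGlobalLerayHopf ν (fun _ => g) v₀ v) (hV : Continuous V) (hT : 0 < T) :
    IntegrableOn (fun τ => ∫ x, ‖v τ x - V x‖ ^ 2) (Set.Ioc 0 T) := by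
  have H := hLH T hT
  have hVL2 : MemLp V 2 volume := memLp_two_of_continuous hV
  have hK := ReductionOffZero.integrableOn_integral_norm_sq hν hg hLH hT
  -- joint measurability on `(0, T) × T²`, then Fubini
  have hmeas : AEStronglyMeasurable (fun τ => ∫ x, ‖v τ x - V x‖ ^ 2) (volume.restrict (Set.Ioc 0 T)) := by
    have h1 : AEStronglyMeasurable (fun p : ℝ × UnitAddTorus (Fin 2) => ‖Function.uncurry v p - V p.2‖ ^ 2)
        ((volume.restrict (Set.Ioo 0 T)).prod volume) :=
      (continuous_pow 2).comp_aestronglyMeasurable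
        (H.aestronglyMeasurable_uncurry.sub (hV.comp continuous_snd).aestronglyMeasurable).norm
    have h2 : AEStronglyMeasurable (fun τ => ∫ x, ‖v τ x - V x‖ ^ 2) (volume.restrict (Set.Ioo 0 T)) :=
      h1.integral_prod_right'
    rwa [Measure.restrict_congr_set Ioo_ae_eq_Ioc] at h2
  -- domination by `2∫‖v‖² + 2∫‖V‖²` on `(0, T]`
  refine Integrable.mono' (g := fun τ => 2 * (∫ x, ‖v τ x‖ ^ 2) + 2 * ∫ x, ‖V x‖ ^ 2)
    ((hK.const_mul 2).add (integrable_const _)) hmeas ?_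
  filter_upwards [ae_restrict_mem measurableSet_Ioc] with τ hτ
  rw [Real.norm_eq_abs, abs_of_nonneg (integral_nonneg fun x => sq_nonneg _)]
  exact integral_norm_sub_sq_le_two_mul_add (H.memLp τ (Set.Ioc_subset_Icc_self hτ)) hVL2

/-- **(E2) Running-mean bound for the fluctuation energy**: for `T > 0`,
`timeMean (∫‖v − V‖²) T ≤ 2 · timeMean (∫‖v‖²) T + 2∫‖V‖²` (slice bound on `(0, T]`,
monotonicity and additivity of the running means). [folklore] -/
theorem timeMean_integral_norm_sub_sq_le (hν : 0 < ν) (hg : MemLp g 2 volume)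
    (hLH : Torus.IsGlobalLerayHopf ν (fun _ => g) v₀ v) (hV : Continuous V) (hT : 0 < T) :
    timeMean (fun τ => ∫ x, ‖v τ x - V x‖ ^ 2) T ≤
      2 * timeMean (fun τ => ∫ x, ‖v τ x‖ ^ 2) T + 2 * ∫ x, ‖V x‖ ^ 2 := by
  have H := hLH T hT
  have hVL2 : MemLp V 2 volume := memLp_two_of_continuous hV
  have hK := ReductionOffZero.integrableOn_integral_norm_sq hν hg hLH hT
  set C : ℝ := ∫ x, ‖V x‖ ^ 2
  have hC0 : 0 ≤ C := integral_nonneg fun x => sq_nonneg _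
  have hKc : IntegrableOn (fun τ => 2 * ∫ x, ‖v τ x‖ ^ 2) (Set.Ioc 0 T) := hK.const_mul 2
  have hcc : IntegrableOn (fun _ : ℝ => 2 * C) (Set.Ioc 0 T) := integrableOn_const (hs := measure_Ioc_lt_top.ne)
  calc timeMean (fun τ => ∫ x, ‖v τ x - V x‖ ^ 2) T
      ≤ timeMean (fun τ => 2 * (∫ x, ‖v τ x‖ ^ 2) + 2 * C) T := by
        refine timeMean_mono_of_nonneg hT.le (fun τ => ?_) (hKc.add hcc) fun τ hτ hτT => ?_
        · exact add_nonneg (mul_nonneg zero_le_two (integral_nonneg fun x => sq_nonneg _))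
            (mul_nonneg zero_le_two hC0)
        · exact integral_norm_sub_sq_le_two_mul_add (H.memLp τ ⟨hτ.le, hτT⟩) hVL2
    _ = 2 * timeMean (fun τ => ∫ x, ‖v τ x‖ ^ 2) T + 2 * C := by
        rw [timeMean_add hT.le hKc hcc, timeMean_const_mul]
        congr 1
        unfold timeMean
        rw [intervalIntegral.integral_const, smul_eq_mul, sub_zero, ← mul_assoc, inv_mul_cancel₀ hT.ne', one_mul]

end FluctuationMeans

/-- **Stub E — velocity-side means around a steady field.** For a global Leray–Hopf solution under
a steady `L²` force and a continuous steady field `V`: the fluctuation energy `∫‖u(τ) − V‖²` is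
integrable on every `(0, T]`, and its running mean is at most `2` (running mean energy)
`+ 2∫‖V‖²`. [folklore] -/
theorem stub_condensateFluctuationMeans :
    ∀ (ν : ℝ) (g : UnitAddTorus (Fin 2) → EuclideanSpace ℝ (Fin 2))
      (v₀ : UnitAddTorus (Fin 2) → EuclideanSpace ℝ (Fin 2))
      (v : ℝ → UnitAddTorus (Fin 2) → EuclideanSpace ℝ (Fin 2))
      (V : UnitAddTorus (Fin 2) → EuclideanSpace ℝ (Fin 2)),
      0 < ν → MemLp g 2 volume → Torus.IsGlobalLerayHopf ν (fun _ => g) v₀ v → Continuous V →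
      (∀ T, 0 < T → IntegrableOn (fun τ => ∫ x, ‖v τ x - V x‖ ^ 2) (Set.Ioc 0 T)) ∧
      (∀ T, 0 < T → timeMean (fun τ => ∫ x, ‖v τ x - V x‖ ^ 2) T ≤
        2 * timeMean (fun τ => ∫ x, ‖v τ x‖ ^ 2) T + 2 * ∫ x, ‖V x‖ ^ 2) := by
  intro ν g v₀ v V hν hg hLH hV
  exact ⟨fun T hT => FluctuationMeans.integrableOn_integral_norm_sub_sq hν hg hLH hV hT,
    fun T hT => FluctuationMeans.timeMean_integral_norm_sub_sq_le hν hg hLH hV hT⟩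

end Summit.AnomalousDissipation.AnomalousDissipation.Theorems.TwohalfdNeg.Condensate
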